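import Summits.HodgeConjecture.Ring2.RowFourTypeIVOneOne
import Literature.AlgebraicGeometry.HodgeTheory.RealMultiplicationRelDimTwoPowersHodgeClasses
import HarnessLib

/-!
# Ring 2 (cell topic `Summits/HodgeConjecture/Ring2/`; seat `lit`, gen 70, R47-P3): TYPE I(2) LEAVES THE ROW-FOUR RESIDUAL — real multiplication of relative dimension two is unconditionally divisorial in all codimensions and all powers

HONEST FRAMING (cell `pub-hodge-ring2`, verbatim): research route conditional on HC_CM; not a corollary;
Q11.4-sentence-2 already refuted in dim ≥ 3. `HC_CM` does NOT occur in this file. Markman's theorem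
(`Markman2025_weilClasses_algebraic_abelianFourfold`) is a HYPOTHESIS of the axis theorems of §2, never asserted.
Theorems only — no definition, no named fact, no `sorry`.

THE PRINT. B. Moonen, Yu. Zarhin, *Hodge classes and Tate classes on simple abelian fourfolds*, Duke Math. J. **77**
(1995), Type I(2): a simple abelian fourfold `X` with `End⁰(X) = F` a real quadratic field has `Hg(X) = R_{F/ℚ} Sp_{4,F}`
and `B•(X) = D•(X)`; V. K. Murty, Math. Ann. **268** (1984) §3 with K. Ribet, Amer. J. Math. **105** (1983) Thm. 0:
`Hg = Lf ⟹ Hdg(Aⁿ) = Div(Aⁿ)` for all `n`.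

THIS FILE. Input: the Literature lane's UNCONDITIONAL `RealMultiplicationRelDimTwoPowersHodgeClasses` (lit g70, R47:
the admissible-Lie-algebra theorem on four-dimensional real blocks `Motives/HodgeThetaSubalgebraSymplecticBlocks`, the
invariance theorem `AVSlots.exists_rm2Invariant_coeff`, the coloured passage `𝔰𝔭₄ → Sp₄` and the coloured symplectic
tensor FFT, the symplectic classes `b_τ0 ⌣ b_τ2 + b_τ1 ⌣ b_τ3 ∈ B¹ ⊗ ℂ`; packaged as
`AbelianVariety.isDivisorGenerated_of_isTotallyReal_of_two_mul_finrank_eq`: `End⁰(A) = F` a totally real field with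
`2[F:ℚ] = dim A` ⟹ `B•(A) ⊆ D•(A) ⊗ ℂ`, in every dimension, and the same for all powers).
* §0 the cell, pointwise and UNCONDITIONAL (no Markman, no `HC_CM`): `hodgeConjectureFor_of_isTotallyReal_of_two_mul_finrank_eq`,
  `isCodimTwoDivisorWeilGenerated_of_isTotallyReal_of_two_mul_finrank_eq`, `relDimTwoRM_hcOnClass`.
* §1 **`moonenZarhin1999_codimTwoHodgeClasses_abelianFourfold_iff_residual_noRelDimTwoRM`** — the FOURFOLD FACT is
  EQUIVALENT to `B² ⊆ D² + Σ W_K` on the simple non-CM fourfolds with no imaginary quadratic endomorphism algebra, NOT of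
  minimal quaternion type, NOT of maximal real-multiplication type, NOT OF REAL-MULTIPLICATION TYPE OF RELATIVE DIMENSION
  TWO (`¬ ∃ hF, IsTotallyReal (EndField A hF) ∧ 2 · finrank_ℚ End⁰ = dim`), NOT of quartic CM type `{(1,1),(2,0)}` — what
  is left of Moonen–Zarhin 1995: types I(1) (`End⁰ = ℚ`), II and III over `ℚ`, IV(2,1) `⊇ k` of signature `(2,2)`,
  IV with `d = 2`.
* §2 **`hcUpToDim_five_iff_rowFour_noRelDimTwoRM_of_markman`**, `hcAtDim_four_iff_rowFour_noRelDimTwoRM_of_markman` —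
  MODULO MARKMAN ALONE, `HCUpToDim 5` / `HCAtDim 4` are EQUIVALENT to the Hodge conjecture on that residual class;
  `rowFourNoRelDimTwoRM_hcOnClass_of_hodgeConjecture` (on path).

WHAT IS NOT CLAIMED: the residual is NOT closed; Markman is never asserted; no `HC_CM`.

## References
* [MoonenZarhin1995Duke] B. Moonen, Yu. Zarhin, Duke Math. J. 77 (1995), the type I(2) row.
* [MoonenZarhin1999LowDim] B. Moonen, Yu. Zarhin, Math. Ann. 315 (1999), Thm. 0.1, §2 (2.2)–(2.5).
* [Murty1984] V. K. Murty, Math. Ann. 268 (1984), §3.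
* [Ribet1983] K. A. Ribet, Amer. J. Math. 105 (1983), Thm. 0.
* [Deligne2000] P. Deligne, *The Hodge conjecture* (Clay problem description, 2000), §1.
* [claim: Markman2025SurveySecant, status: under-review] E. Markman, arXiv:2509.23403, Thm. 1.2.
-/

noncomputable section

open CategoryTheory CategoryTheory.Limits

namespace Summit.HodgeConjecture.Ring2.RowFourTypeITwo

open Literature.AlgebraicGeometry.Motives (AbelianVariety)
open Literature.AlgebraicGeometry.Motives.AbelianVariety
open Literature.AlgebraicGeometry.HodgeTheory
open Literature.AlgebraicGeometry.ComplexMultiplication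
open Literature.AlgebraicGeometry.Milne1999
open NumberField
open Literature.NumberTheory.Automorphic (IsQuaternionAlgebra)
open Summit.HodgeConjecture.HodgeConjecture.Ring2.ClassTargets
open Summit.HodgeConjecture.Ring2.FivefoldFactHolds
open Summit.HodgeConjecture.Ring2.NonSimpleFourfoldsCodimTwo
open Summit.HodgeConjecture.Ring2.RowFourTypeIVOneOne

variable {X : AbelianVariety ℂ}

/-! ### §0 The cell: real multiplication of relative dimension two, unconditionally -/

/-- **The Hodge conjecture for every complex abelian variety whose endomorphism algebra is a totally real field `F`
with `2[F:ℚ] = dim` — UNCONDITIONAL** (every dimension; for `dim = 4` the simple fourfolds of Type I(2)); the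
Literature lane's `hodgeConjectureFor_of_isTotallyReal_two_mul_finrank_eq_dim`. [cite: MoonenZarhin1995Duke, Type I(2)]
[cite: Murty1984, §3] [cite: Ribet1983, Thm. 0] -/
theorem hodgeConjectureFor_of_isTotallyReal_of_two_mul_finrank_eq (hF : IsField X.endAlgebra)
    (hT : IsTotallyReal (EndField X hF)) (he : 2 * Module.finrank ℚ X.endAlgebra = X.dim) :
    HodgeConjectureFor X.dim X.X :=
  hodgeConjectureFor_of_isTotallyReal_two_mul_finrank_eq_dim X hF hT he

/-- **All powers**: the Hodge conjecture for `X^{N+1}`, `End⁰(X) = F` totally real with `2[F:ℚ] = dim X` — UNCONDITIONAL.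
[cite: Ribet1983, Thm. 0] [cite: MoonenZarhin1995Duke, Type I(2)] -/
theorem hodgeConjectureFor_powSucc_of_isTotallyReal_of_two_mul_finrank_eq (hF : IsField X.endAlgebra)
    (hT : IsTotallyReal (EndField X hF)) (he : 2 * Module.finrank ℚ X.endAlgebra = X.dim) (N : ℕ) :
    HodgeConjectureFor (X.powSucc N).dim (X.powSucc N).X :=
  hodgeConjectureFor_powSucc_of_isTotallyReal_two_mul_finrank_eq_dim X hF hT he N

/-- **`B² ⊆ D² (+ Σ W_K)`** for such an `X` (all codimensions are divisorial: `IsDivisorGenerated X`).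
[cite: MoonenZarhin1995Duke, Type I(2)] [cite: MoonenZarhin1999LowDim, Thm. 0.1] -/
theorem isCodimTwoDivisorWeilGenerated_of_isTotallyReal_of_two_mul_finrank_eq (hF : IsField X.endAlgebra)
    (hT : IsTotallyReal (EndField X hF)) (he : 2 * Module.finrank ℚ X.endAlgebra = X.dim) :
    IsCodimTwoDivisorWeilGenerated X :=
  haveI := hT
  (AbelianVariety.isDivisorGenerated_of_isTotallyReal_of_two_mul_finrank_eq X hF he).isCodimTwoDivisorWeilGenerated

/-- **The class of abelian varieties with real multiplication of relative dimension two is a CLOSED class target,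
unconditionally** (`HCOnClass`, no Markman, no `HC_CM`). [cite: MoonenZarhin1995Duke, Type I(2)] [cite: Murty1984, §3] -/
theorem relDimTwoRM_hcOnClass :
    HCOnClass fun A => ∃ hF : IsField A.endAlgebra, IsTotallyReal (EndField A hF) ∧
      2 * Module.finrank ℚ A.endAlgebra = A.dim := by
  rintro A ⟨hF, hT, he⟩
  exact hodgeConjectureFor_of_isTotallyReal_of_two_mul_finrank_eq hF hT he

/-- **On path**: the class is a case of the summit. [cite: Deligne2000, §1] -/
theorem relDimTwoRM_hcOnClass_of_hodgeConjecture (h : _root_.HodgeConjecture) :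
    HCOnClass fun A => ∃ hF : IsField A.endAlgebra, IsTotallyReal (EndField A hF) ∧
      2 * Module.finrank ℚ A.endAlgebra = A.dim :=
  hcOnClass_of_hodgeConjecture _ h

/-! ### §1 The fourfold fact localised past type I(2) -/

/-- **THE RESIDUAL OF THE FOURFOLD FACT, FIFTH REFINEMENT — TYPE I(2) REMOVED.** The named fact
`MoonenZarhin1999_codimTwoHodgeClasses_abelianFourfold` (Thm. 0.1 in codimension two) is EQUIVALENT to its instances at
the simple non-CM fourfolds whose endomorphism algebra is NOT an imaginary quadratic field, which are NOT of minimal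
quaternion type, NOT of maximal real-multiplication type, NOT of real-multiplication type of relative dimension two
(`¬ ∃ hF, IsTotallyReal (EndField A hF) ∧ 2 · finrank_ℚ End⁰(A) = dim A`) and NOT of quartic CM type `{(1,1),(2,0)}`: the
type I(2) row is now the Literature lane's UNCONDITIONAL `AbelianVariety.isDivisorGenerated_of_isTotallyReal_of_two_mul_finrank_eq`.
[cite: MoonenZarhin1995Duke, the type I(2) row] [cite: MoonenZarhin1999LowDim, Thm. 0.1, §2 (2.2)–(2.5)] [cite: Murty1984, §3] -/
theorem moonenZarhin1999_codimTwoHodgeClasses_abelianFourfold_iff_residual_noRelDimTwoRM :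
    MoonenZarhin1999_codimTwoHodgeClasses_abelianFourfold ↔
      ∀ A : AbelianVariety ℂ, A.dim = 4 → A.IsSimple → ¬ IsOfCMType A →
        (¬ ∃ (φ : A ⟶ A) (d : ℕ), 0 < d ∧ φ ≫ φ = -(d • 𝟙 A) ∧ Module.finrank ℚ A.endAlgebra = 2) →
        (¬ ∃ (K : Type) (_ : Field K) (_ : NumberField K) (_ : IsTotallyReal K) (_ : Algebra K A.endAlgebra)
          (_ : IsScalarTower ℚ K A.endAlgebra) (_ : IsQuaternionAlgebra K A.endAlgebra),
            A.dim = 2 * Module.finrank ℚ K) →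
        (¬ ∃ hF : IsField A.endAlgebra, NumberField.IsTotallyReal (EndField A hF) ∧
          Module.finrank ℚ A.endAlgebra = A.dim) →
        (¬ ∃ hF : IsField A.endAlgebra, NumberField.IsTotallyReal (EndField A hF) ∧
          2 * Module.finrank ℚ A.endAlgebra = A.dim) →
        (¬ ∃ (φ : A ⟶ A) (μ₁ μ₂ : ℂ), Module.finrank ℚ A.endAlgebra = 4 ∧ starRingEnd ℂ μ₁ ≠ μ₁ ∧
          starRingEnd ℂ μ₂ ≠ μ₂ ∧ μ₂ ≠ μ₁ ∧ μ₂ ≠ starRingEnd ℂ μ₁ ∧ eigenMultiplicity A φ μ₁ = 1 ∧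
          eigenMultiplicity A φ (starRingEnd ℂ μ₁) = 1 ∧ eigenMultiplicity A φ μ₂ = 2) →
        IsCodimTwoDivisorWeilGenerated A := by
  rw [moonenZarhin1999_codimTwoHodgeClasses_abelianFourfold_iff_residual_noImaginaryQuadratic]
  refine ⟨fun h A hA hs hcm hK hQ hT _ hC => h A hA hs hcm hK hQ hT hC, fun h A hA hs hcm hK hQ hT hC => ?_⟩
  by_cases hR : ∃ hF : IsField A.endAlgebra, NumberField.IsTotallyReal (EndField A hF) ∧
      2 * Module.finrank ℚ A.endAlgebra = A.dim
  · obtain ⟨hF, hTR, he⟩ := hR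
    exact isCodimTwoDivisorWeilGenerated_of_isTotallyReal_of_two_mul_finrank_eq hF hTR he
  exact h A hA hs hcm hK hQ hT hR hC

/-! ### §2 The HC axis modulo MARKMAN ALONE: row four without types IV(1,1) and I(2) -/

/-- **`HCUpToDim 5` MODULO MARKMAN ALONE, TYPES IV(1,1) AND I(2) REMOVED**: granted
`Markman2025_weilClasses_algebraic_abelianFourfold` (hypothesis; no `HC_CM`), the Hodge conjecture for all complex abelian
varieties of dimension `≤ 5` is EQUIVALENT to the Hodge conjecture on the simple non-CM FOURFOLDS whose endomorphism
algebra is NOT an imaginary quadratic field and which are of none of the four types minimal quaternion, maximal real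
multiplication, real multiplication of relative dimension two, quartic CM `{(1,1),(2,0)}` — what is left of
Moonen–Zarhin 1995: types I(1) (`End⁰ = ℚ`), II and III over `ℚ`, IV(2,1) `⊇ k` of signature `(2,2)`, IV with `d = 2`.
[cite: MoonenZarhin1999LowDim, Thm. 0.1, Thm. 0.2 and §2 (2.5)] [cite: MoonenZarhin1995Duke, the type I(2) row]
[cite: Murty1984, §3] [claim: Markman2025SurveySecant, status: under-review] -/
theorem hcUpToDim_five_iff_rowFour_noRelDimTwoRM_of_markman
    (hMark : Markman2025_weilClasses_algebraic_abelianFourfold) :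
    HCUpToDim 5 ↔ HCOnClass fun A => A.dim = 4 ∧ A.IsSimple ∧ ¬ IsOfCMType A ∧
      (¬ ∃ (φ : A ⟶ A) (d : ℕ), 0 < d ∧ φ ≫ φ = -(d • 𝟙 A) ∧ Module.finrank ℚ A.endAlgebra = 2) ∧
      (¬ ∃ (K : Type) (_ : Field K) (_ : NumberField K) (_ : IsTotallyReal K) (_ : Algebra K A.endAlgebra)
        (_ : IsScalarTower ℚ K A.endAlgebra) (_ : IsQuaternionAlgebra K A.endAlgebra), A.dim = 2 * Module.finrank ℚ K) ∧
      (¬ ∃ hF : IsField A.endAlgebra, IsTotallyReal (EndField A hF) ∧ Module.finrank ℚ A.endAlgebra = A.dim) ∧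
      (¬ ∃ hF : IsField A.endAlgebra, IsTotallyReal (EndField A hF) ∧ 2 * Module.finrank ℚ A.endAlgebra = A.dim) ∧
      (¬ ∃ (φ : A ⟶ A) (μ₁ μ₂ : ℂ), Module.finrank ℚ A.endAlgebra = 4 ∧ starRingEnd ℂ μ₁ ≠ μ₁ ∧
        starRingEnd ℂ μ₂ ≠ μ₂ ∧ μ₂ ≠ μ₁ ∧ μ₂ ≠ starRingEnd ℂ μ₁ ∧ eigenMultiplicity A φ μ₁ = 1 ∧
        eigenMultiplicity A φ (starRingEnd ℂ μ₁) = 1 ∧ eigenMultiplicity A φ μ₂ = 2) := by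
  rw [hcUpToDim_five_iff_rowFour_noImaginaryQuadratic_of_markman hMark]
  refine ⟨fun h => hcOnClass_mono (fun A hA => ⟨hA.1, hA.2.1, hA.2.2.1, hA.2.2.2.1, hA.2.2.2.2.1, hA.2.2.2.2.2.1,
      hA.2.2.2.2.2.2.2⟩) h, fun h A hA => ?_⟩
  obtain ⟨hA4, hs, hcm, hK, hQ, hT, hC⟩ := hA
  by_cases hR : ∃ hF : IsField A.endAlgebra, IsTotallyReal (EndField A hF) ∧ 2 * Module.finrank ℚ A.endAlgebra = A.dim
  · obtain ⟨hF, hTR, he⟩ := hR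
    exact hodgeConjectureFor_of_isTotallyReal_of_two_mul_finrank_eq hF hTR he
  exact h A ⟨hA4, hs, hcm, hK, hQ, hT, hR, hC⟩

/-- **`HCAtDim 4` MODULO MARKMAN, TYPES IV(1,1) AND I(2) REMOVED** (the row-`4` cell alone).
[cite: MoonenZarhin1995Duke, the type I(2) row] [cite: MoonenZarhin1999LowDim, Thm. 0.1]
[claim: Markman2025SurveySecant, status: under-review] -/
theorem hcAtDim_four_iff_rowFour_noRelDimTwoRM_of_markman
    (hMark : Markman2025_weilClasses_algebraic_abelianFourfold) :
    HCAtDim 4 ↔ HCOnClass fun A => A.dim = 4 ∧ A.IsSimple ∧ ¬ IsOfCMType A ∧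
      (¬ ∃ (φ : A ⟶ A) (d : ℕ), 0 < d ∧ φ ≫ φ = -(d • 𝟙 A) ∧ Module.finrank ℚ A.endAlgebra = 2) ∧
      (¬ ∃ (K : Type) (_ : Field K) (_ : NumberField K) (_ : IsTotallyReal K) (_ : Algebra K A.endAlgebra)
        (_ : IsScalarTower ℚ K A.endAlgebra) (_ : IsQuaternionAlgebra K A.endAlgebra), A.dim = 2 * Module.finrank ℚ K) ∧
      (¬ ∃ hF : IsField A.endAlgebra, IsTotallyReal (EndField A hF) ∧ Module.finrank ℚ A.endAlgebra = A.dim) ∧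
      (¬ ∃ hF : IsField A.endAlgebra, IsTotallyReal (EndField A hF) ∧ 2 * Module.finrank ℚ A.endAlgebra = A.dim) ∧
      (¬ ∃ (φ : A ⟶ A) (μ₁ μ₂ : ℂ), Module.finrank ℚ A.endAlgebra = 4 ∧ starRingEnd ℂ μ₁ ≠ μ₁ ∧
        starRingEnd ℂ μ₂ ≠ μ₂ ∧ μ₂ ≠ μ₁ ∧ μ₂ ≠ starRingEnd ℂ μ₁ ∧ eigenMultiplicity A φ μ₁ = 1 ∧
        eigenMultiplicity A φ (starRingEnd ℂ μ₁) = 1 ∧ eigenMultiplicity A φ μ₂ = 2) := by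
  constructor
  · exact fun h => hcOnClass_mono (fun A hA => hA.1) h
  · intro h
    have h5 : HCUpToDim 5 := (hcUpToDim_five_iff_rowFour_noRelDimTwoRM_of_markman hMark).2 h
    exact hcOnClass_mono (fun A (hA : A.dim = 4) => show A.dim ≤ 5 by omega) h5

/-- **On path**: the residual class is a case of the summit. [cite: Deligne2000, §1] -/
theorem rowFourNoRelDimTwoRM_hcOnClass_of_hodgeConjecture (h : _root_.HodgeConjecture) :
    HCOnClass fun A => A.dim = 4 ∧ A.IsSimple ∧ ¬ IsOfCMType A ∧
      (¬ ∃ (φ : A ⟶ A) (d : ℕ), 0 < d ∧ φ ≫ φ = -(d • 𝟙 A) ∧ Module.finrank ℚ A.endAlgebra = 2) ∧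
      (¬ ∃ (K : Type) (_ : Field K) (_ : NumberField K) (_ : IsTotallyReal K) (_ : Algebra K A.endAlgebra)
        (_ : IsScalarTower ℚ K A.endAlgebra) (_ : IsQuaternionAlgebra K A.endAlgebra), A.dim = 2 * Module.finrank ℚ K) ∧
      (¬ ∃ hF : IsField A.endAlgebra, IsTotallyReal (EndField A hF) ∧ Module.finrank ℚ A.endAlgebra = A.dim) ∧
      (¬ ∃ hF : IsField A.endAlgebra, IsTotallyReal (EndField A hF) ∧ 2 * Module.finrank ℚ A.endAlgebra = A.dim) ∧
      (¬ ∃ (φ : A ⟶ A) (μ₁ μ₂ : ℂ), Module.finrank ℚ A.endAlgebra = 4 ∧ starRingEnd ℂ μ₁ ≠ μ₁ ∧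
        starRingEnd ℂ μ₂ ≠ μ₂ ∧ μ₂ ≠ μ₁ ∧ μ₂ ≠ starRingEnd ℂ μ₁ ∧ eigenMultiplicity A φ μ₁ = 1 ∧
        eigenMultiplicity A φ (starRingEnd ℂ μ₁) = 1 ∧ eigenMultiplicity A φ μ₂ = 2) :=
  hcOnClass_of_hodgeConjecture _ h

end Summit.HodgeConjecture.Ring2.RowFourTypeITwo

end
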